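import Summits.ABC.IUTFork.Joshi.TestDictionaryCalibrationPlaces
import Summits.ABC.IUTFork.Cor312PinnedIndTrivial
import HarnessLib

/-!
# Branch E TEST vs S — the calibration across places, IV: (Ind)-TRIVIAL instantiations need no place-separability

Record file of the abc-iut cell, branch E (rung LADDER-ABC:A2.E; seat abc-iut-E-t42 gen 2, row T-42e; sequel of
`Joshi/TestDictionaryCalibrationPlaces.lean` p438822, `…PlacesModel.lean` p439174, `…PlacesDiag.lean` p440540). **No side is taken** on
[IUTchIII] Cor. 3.12 or on any author (Mochizuki / Scholze–Stix / Joshi); typed ≠ proved; located, not adjudicated.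

THE SECOND SUFFICIENT CONDITION. Parts I–III: X-01's hypothesis set `DictionaryRealizable` ⟺ `UniformIndRelated` ⟺
S := `PilotKummerIndRelated` under (hρ) at every PLACE-SEPARABLE index, and not in general (S as typed is packet-local; the excess of
the one-indeterminacy forms is (Ind1)'s diagonal capsule permutation). abc-iut-w5-d068's `Cor312PinnedIndTrivial` (p429312) records the
other structural fact about the cell's models: EVERY pinned model of record is (Ind)-TRIVIAL — the indeterminacy group FIXES the
(Ind3)-enlarged Θ-region `thetaRegion3` at every packet (`IndTrivial.models_of_record_indTrivial`; there S ⟺ literal equality of the two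
Kummer-image regions, `IndTrivial.residual_iff_regions_eq_pinned`). THIS FILE (proof-only, no definition, no `Prop` fact):
* `uniformIndRelated_of_pilotKummerIndRelated_of_indTrivial` — on an (Ind)-trivial setting, under the two region pins and Thm. 3.11
  (ii)(b) for the column, S ⟹ `UniformIndRelated` with the witness `Φ := 1`, at EVERY index (no place-separability, no (hρ) beyond the
  pins);
* **`dictionaryRealizable_iff_pilotKummerIndRelated_of_indTrivial`** — hence X-01's hypothesis set ⟺ `UniformIndRelated` ⟺ S there,
  at every index;
* `twoPlace_not_indTrivial_type` — consistency remark: part II's two-place separating instantiation (S ∧ ¬UniformIndRelated) is therefore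
  NOT of the (Ind)-trivial pinned type — stated as the contrapositive «S ∧ ¬UniformIndRelated ⟹ ¬((Ind)-trivial ∧ pins ∧ (ii)(b))» over
  arbitrary binders.
So the calibration «X-01 ⟺ S» holds for TWO independent structural reasons covering every model of record twice over (one place;
(Ind)-trivial), and fails only at instantiations that are simultaneously many-place, non-separable and (Ind)-non-trivial (part II's
witness). Located, not adjudicated. [claim: Mochizuki2012, status: disputed] [claim: Joshi2024ATS3, status: disputed]
[cite: ScholzeStix2018, §2.2 pp. 9–10]
-/

noncomputable section

open Set

namespace Summit.ABC.IUTFork.Joshi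

open Thm311 Cor312 Cor312Vol Literature.IUT.LogThetaLattice

variable {T : ThetaIndex} {S : LatticeSituation T} {P : Cor312.Setting S.toSituation}
  {ρ : (∀ v : T.V, v ∈ T.Vbad → Set (S.L.StarPacket v)) → ∀ (j : T.Label) (vQ : T.VQ), Set (S.L.Packet j vQ)}
  {qK : ∀ v : T.V, v ∈ T.Vbad → Set (S.L.StarPacket v)}

/-- **S ⟹ the uniform residual on an (Ind)-TRIVIAL pinned setting, at EVERY index**: the indeterminacy group fixes `thetaRegion3`, so
under the two region pins and Thm. 3.11 (ii)(b) S reads `ρ qK = ρ Ψ_n` everywhere (abc-iut-w5-d068 `IndTrivial.residual_iff_regions_eq_pinned`)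
and the IDENTITY is a uniform witness. No place-separability needed. [claim: Mochizuki2012, status: disputed] -/
theorem uniformIndRelated_of_pilotKummerIndRelated_of_indTrivial
    (hfix : ∀ Φ ∈ Setting.indGroup S.toSituation, ∀ (j : T.Label) (vQ : T.VQ), Φ j vQ '' P.thetaRegion3 j vQ = P.thetaRegion3 j vQ)
    (hKumB : (S.col P.n).KummerB (S.D P.n)) (hpin : PinnedRegions S P ρ qK) (h : PilotKummerIndRelated S P ρ qK) :
    UniformIndRelated S P ρ qK := by
  refine ⟨1, one_mem _, fun j vQ => ?_⟩
  rw [(IndTrivial.residual_iff_regions_eq_pinned S P ρ qK hfix hKumB hpin).1 h j vQ, Pi.one_apply, Pi.one_apply,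
    LinearEquiv.coe_one, Set.image_id]

/-- **CALIBRATION ON (Ind)-TRIVIAL PINNED SETTINGS, I**: S ⟺ the uniform residual, at every index. [claim: Mochizuki2012, status: disputed] -/
theorem uniformIndRelated_iff_pilotKummerIndRelated_of_indTrivial
    (hfix : ∀ Φ ∈ Setting.indGroup S.toSituation, ∀ (j : T.Label) (vQ : T.VQ), Φ j vQ '' P.thetaRegion3 j vQ = P.thetaRegion3 j vQ)
    (hKumB : (S.col P.n).KummerB (S.D P.n)) (hpin : PinnedRegions S P ρ qK) :
    UniformIndRelated S P ρ qK ↔ PilotKummerIndRelated S P ρ qK :=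
  ⟨pilotKummerIndRelated_of_uniformIndRelated hpin.1.1,
    uniformIndRelated_of_pilotKummerIndRelated_of_indTrivial hfix hKumB hpin⟩

/-- **CALIBRATION ON (Ind)-TRIVIAL PINNED SETTINGS, II — `dictionaryRealizable_iff_pilotKummerIndRelated_of_indTrivial`**: X-01's
hypothesis set (abc-iut-E-t42 `DictionaryRealizable`, p430744) ⟺ S on every (Ind)-trivial setting under the two region pins and Thm. 3.11
(ii)(b) — at EVERY index. With `IndTrivial.models_of_record_indTrivial` (p429312): a second, index-free reason why the calibration holds
at every model of record. [claim: Joshi2024ATS3, status: disputed] -/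
theorem dictionaryRealizable_iff_pilotKummerIndRelated_of_indTrivial
    (hfix : ∀ Φ ∈ Setting.indGroup S.toSituation, ∀ (j : T.Label) (vQ : T.VQ), Φ j vQ '' P.thetaRegion3 j vQ = P.thetaRegion3 j vQ)
    (hKumB : (S.col P.n).KummerB (S.D P.n)) (hpin : PinnedRegions S P ρ qK) :
    DictionaryRealizable S P ρ qK ↔ PilotKummerIndRelated S P ρ qK :=
  (dictionaryRealizable_iff_uniformIndRelated hpin.1.1).trans
    (uniformIndRelated_iff_pilotKummerIndRelated_of_indTrivial hfix hKumB hpin)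

/-- … and ⟺ READING R3 (the q-region is a possible image at every packet) there. [claim: Mochizuki2012, status: disputed] -/
theorem dictionaryRealizable_iff_reading3_of_indTrivial
    (hfix : ∀ Φ ∈ Setting.indGroup S.toSituation, ∀ (j : T.Label) (vQ : T.VQ), Φ j vQ '' P.thetaRegion3 j vQ = P.thetaRegion3 j vQ)
    (hKumB : (S.col P.n).KummerB (S.D P.n)) (hpin : PinnedRegions S P ρ qK) :
    DictionaryRealizable S P ρ qK ↔ ∀ (j : T.Label) (vQ : T.VQ), P.qRegion j vQ ∈ P.possibleImages j vQ :=
  (dictionaryRealizable_iff_pilotKummerIndRelated_of_indTrivial hfix hKumB hpin).trans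
    (reading3_iff_pilotKummerIndRelated S P ρ qK hKumB hpin).symm

/-- **Consistency remark**: an instantiation separating S from the uniform residual (part II's two-place witness
`pilotKummerIndRelated_not_imp_uniformIndRelated`) can NOT be an (Ind)-trivial setting carrying the two region pins and Thm. 3.11
(ii)(b) — the separating instantiations are simultaneously many-place, non-place-separable (part I §2) and (Ind)-non-trivial. [folklore] -/
theorem not_indTrivial_pinned_of_separating (hS : PilotKummerIndRelated S P ρ qK) (hU : ¬ UniformIndRelated S P ρ qK) :
    ¬ ((∀ Φ ∈ Setting.indGroup S.toSituation, ∀ (j : T.Label) (vQ : T.VQ), Φ j vQ '' P.thetaRegion3 j vQ = P.thetaRegion3 j vQ) ∧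
        (S.col P.n).KummerB (S.D P.n) ∧ PinnedRegions S P ρ qK) :=
  fun ⟨hfix, hKumB, hpin⟩ => hU (uniformIndRelated_of_pilotKummerIndRelated_of_indTrivial hfix hKumB hpin hS)

/-- The same for place-separability: a separating instantiation satisfying (hρ) lives on a NON-place-separable signature (part I §2,
contraposed). [folklore] -/
theorem not_indPlaceSeparable_of_separating
    (hρ : ∀ Φ ∈ Subgroup.closure (S.L.Ind1Family ∪ S.L.Ind2Family),
      ∀ (Ψ : ∀ v : T.V, v ∈ T.Vbad → Set (S.L.StarPacket v)) (j : T.Label) (vQ : T.VQ),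
        ρ (fun v hv => S.L.starAut Φ v '' Ψ v hv) j vQ = Φ j vQ '' ρ Ψ j vQ)
    (hS : PilotKummerIndRelated S P ρ qK) (hU : ¬ UniformIndRelated S P ρ qK) : ¬ IndPlaceSeparable S.L :=
  fun hsep => hU (uniformIndRelated_of_pilotKummerIndRelated_of_separable hsep hρ hS)

/-! ## Instances: the pinned countermodel of record and the whole `withQDatum` family -/

section Instances

open Cor312.Checks Cor312.IdentifiedNonVacuity Cor312Vol.NaiveWitness Cor312Vol.GluedMonoids.Naive

variable (p : ℕ) [hp : Fact p.Prime]

/-- **At abc-iut-w4-d101's pinned countermodel of record** (p419720; (Ind)-trivial by `IndTrivial.indTrivial_pinnedSetting`): X-01's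
hypothesis set ⟺ S, obtained through (Ind)-triviality (both sides FALSE there, p430744 `pinnedSetting_not_dictionaryRealizable`). [folklore] -/
theorem pinnedSetting_dictionaryRealizable_iff :
    DictionaryRealizable (naiveFull p).toLatticeSituation (PinnedWitness.pinnedSetting p) (PinnedWitness.orbitRegion p)
        (PinnedWitness.qDatum p) ↔
      PilotKummerIndRelated (naiveFull p).toLatticeSituation (PinnedWitness.pinnedSetting p) (PinnedWitness.orbitRegion p)
        (PinnedWitness.qDatum p) :=
  dictionaryRealizable_iff_pilotKummerIndRelated_of_indTrivial (IndTrivial.indTrivial_pinnedSetting p) (naive_kummerB p _)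
    (PinnedWitness.pinnedSetting_pinnedRegions3 p).1

/-- **On the WHOLE `withQDatum` family** (abc-iut-w5-d247/c312-3: the naive situation with the q-pilot region generated by ANY
hull-generating bad-place datum `qK` — P♭ = `linkIdSetting`, P♯ = `honestQSetting`, abc-iut-w5-d068's singleton-datum model, …; all
(Ind)-trivial by `IndTrivial.indTrivial_withQDatum`): X-01's hypothesis set ⟺ S, whatever the q-datum. [folklore] -/
theorem withQDatum_dictionaryRealizable_iff (qK : ∀ v : toyIndex.V, v ∈ toyIndex.Vbad → Set (signShells.StarPacket v))
    (hqK : ∀ (j : toyIndex.Label) (vQ : toyIndex.VQ), ∃ k : ℤ, pBall p j vQ k = ballOfMonoid p qK j vQ) :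
    DictionaryRealizable (naiveFull p).toLatticeSituation (withQDatum p qK hqK) (ballOfMonoid p) qK ↔
      PilotKummerIndRelated (naiveFull p).toLatticeSituation (withQDatum p qK hqK) (ballOfMonoid p) qK :=
  dictionaryRealizable_iff_pilotKummerIndRelated_of_indTrivial (IndTrivial.indTrivial_withQDatum p qK hqK) (naive_kummerB p _)
    (withQDatum_pinnedRegions p qK hqK)

end Instances

end Summit.ABC.IUTFork.Joshi

end
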